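import Summits.HodgeConjecture.HodgeConjecture.Theorems.F0P3cStCharTSNormalizedOrbitalH   -- ★ p849681 LH7-p04: `classOrbitalIntegralH_eq_twoCoset_of_spectral` (over ★ p849562)
import Summits.HodgeConjecture.HodgeConjecture.Theorems.F0P3cStCharTSHaeH                 -- ★ p849715 LH7-p04: `ae_ae_isRegularElt_and_isLocalGRegular`
import Literature.NumberTheory.Automorphic.CMPrincipalSeriesHAdmissible                    -- ★ `isAdmissible_cmPrincipalSeriesH`
import Literature.NumberTheory.Automorphic.SmoothTraceMeasureScaling                      -- ★ `Representation.smoothTrace_eq_haarScalarFactor_mul_smoothTrace`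
import Literature.NumberTheory.Rogawski1990.GRegularLocalisation                          -- ★ `isLocalGRegular_out_mk`
import Literature.NumberTheory.Rogawski1990.LocalCentralizerTorusMeasureCM                -- ★ `isRegularElt_fst_snd_of_isLocalGRegular`
import Literature.NumberTheory.Rogawski1990.LocalTransferFundamentalLemma                  -- ★ `IsLocSmooth`
import HarnessLib

/-!
# F0 · P3c · line LH6 «StCharTS» — road (D) «DEEP-FL», brick ② «HOH-SHELL-H»: the canonical `H`-orbital integral of a test function with two-coset PRODUCT-Haar spectral data
# (★ hF1H-ADAPTER's output for ONE `H`-shell indicator `𝟙_{K_H (b, z₁) K_H}`) at a hyperbolic `G`-regular diagonal-Levi point, CLOSED FORM in the organ's own Haar measure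
# — the `hOHj` clause of ★ KIT-A `hOH_of_summands` (p849774) with `Φ_j = κ_H · (𝟙_{C} + 1 · 𝟙_{C′})`, `κ_H` EXPLICIT in `ν_H ∕ μ_T` currency

Cell `pub/hodgecm-mathlib`, crux H413 = `stmt-HodgeConjecture-24833` (`--supports` lane, helper), route HCCMUnconditional; seat LH7-p04 (g2), dealt by the road-(D) owner LH6-p04 (g3)
2026-09-02T06:23:01Z (board ②; ROAD-D STATUS v7 `F0/P3b/LH6-p04/g3/ROAD-D.status.v7.txt`: `hOHj ⇐ ② = hF1H-ADAPTER ∘ ★ p849681∕p849562`).  THEOREMS ONLY (★-only imports; no definition ∕ instance ∕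
notation ∕ named fact ∕ `sorry`).  HONEST LABEL: road-(D) glue, count-neutral — nothing here closes (S-X) `stub_StXIGSt`; the spectral data of the summand (`hF1Hg`, = ★ hF1H-ADAPTER's
output, itself conditional on LH5-p05's W2-c, the Weyl-stability of the torus level and the dominance of the shell point, ★ DOM-GENERAL-H) stays a hypothesis BY SHAPE; HC_CM is proved only modulo the 7
printed citations (2 remaining: hLiu418 = stmt-HodgeConjecture-24832, h413 = stmt-HodgeConjecture-24833) until rung 0 closes.

THE MATHEMATICS ([Rogawski1990, §4.9 (4.9.4) p. 56, §12.1 p. 171, §12.7 L. 12.7.3 proof p. 195]; [HewittRoss1979, (23.11)]).  Compose: (a) ★ hF1H-ADAPTER (p849948) gives the spectral data of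
`g := 𝟙_{K_H (b,z₁) K_H}` for a PRODUCT Haar measure `ν₂ ⊗ ν₁` (here: the hypothesis `hF1Hg`, for any `g`): `tr i_H(χ₂ ⊠ χ₁)(g; ν₂ ⊗ ν₁) = [χ₂|_{C₂} = 1 ∧ χ₁|_{K₁} = 1] · A ·
χ₁(z₁) · (χ₂(b₁) + χ₂(b₂))`, `A = ν₂(K₂)·N·ν₁(K₁)·D` (`K₂ = K_{2,n}`, `N = #R₂`, `D = δ_{B₂}^{1∕2}(b)`); (b) for the organ's Haar measure `ν_H = s · (ν₂ ⊗ ν₁)` the trace scales by `s` (★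
`smoothTrace_eq_haarScalarFactor_mul_smoothTrace`), so `hF1H` holds for `ν_H` with `A′ = s·A`; (c) ★ `classOrbitalIntegralH_eq_twoCoset_of_spectral` (with ★ HAE-H for `hae` at
`P_H := IsLocalGRegular`) at the point `(t_H, u) = γ_H` (regular, `G`-regular by ★ `isRegularElt_fst_snd_of_isLocalGRegular` ∕ ★ `isLocalGRegular_out_mk`) gives
`O^H_{γ_H}(g) = δ_{B₂}^{1∕2}(t_H)⁻¹ · J₂(t_H) · κ_H · (𝟙_{(b,z₁)(C₂×K₁)} + 1·𝟙_{(ʷb,z₁)(C₂×K₁)})(t_H, u)` with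
`κ_H = A′·μ_T(S_{H,v})·ν₁(univ) ∕ (μ_T(C₂)·ν₁(K₁)) = ν_H(K₂ × U(Φ₁)_v) · N · D · μ_T(S_{H,v}) ∕ μ_T(C₂)` — the auxiliary `ν₂, ν₁` CANCEL
(`s·ν₂(K₂)·ν₁(univ) = ν_H(K₂ × univ)`), `S_{H,v} = T₂ ∩ K_{2,v}` (the unit set of ★ p849562, (Q4)), `C₂ = T₂ ∩ K₂`.

* `classOrbitalIntegralH_eq_of_prodHaar_spectral` — ② «HOH-SHELL-H»: KIT-A's `hOHj` clause for one summand `g` from its product-Haar spectral data (`hF1Hg` = ★ p849948's shape),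
  `Φ := fun x => κ_H * (𝟙_C x + 1 * 𝟙_{C′} x)`, `κ_H` in `ν_H ∕ μ_T` currency.

## References
* [Rogawski1990] J. D. Rogawski, *Automorphic Representations of Unitary Groups in Three Variables*, Ann. of Math. Stud. 123 (1990), §4.9 (4.9.4) p. 56; §12.1 p. 171; §12.7 p. 195.
* [HewittRoss1979] E. Hewitt, K. A. Ross, *Abstract Harmonic Analysis I*, 2nd ed. (1979), Thm. (23.11).
-/

set_option autoImplicit false
-- the mandated namespace has the single-problem summit's repeated segment (`HodgeConjecture.HodgeConjecture`)
set_option linter.dupNamespace false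

noncomputable section

open NumberField IsDedekindDomain MeasureTheory MeasureTheory.Measure Topology
open scoped Matrix MatrixGroups NNReal ENNReal Pointwise
open Literature.MeasureTheory.Group
open Literature.NumberTheory Literature.NumberTheory.Automorphic Literature.NumberTheory.Automorphic.UnitaryGroup
open Literature.NumberTheory.Automorphic.UnitaryGroup.HeisRing Literature.NumberTheory.Automorphic.UnitaryGroup.LineRing
open Literature.NumberTheory.Rogawski1990
open Summit.HodgeConjecture.HodgeConjecture.Cruxes.H413.F0P3cStCharTSNormalizedOrbitalH
open Summit.HodgeConjecture.HodgeConjecture.Cruxes.H413.F0P3cStCharTSHaeH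

namespace Summit.HodgeConjecture.HodgeConjecture.Cruxes.H413.F0P3cStCharTSHohShellH

section CM

variable (L : Type) [Field L] [NumberField L] [IsCMField L] (v : HeightOneSpectrum (𝓞 ↥(maximalRealSubfield L)))
  [mHH : MeasurableSpace (((cmDatum L 2 (Matrix.of fun i j : Fin 2 => if i.val + j.val + 1 = 2 then (1 : L) else 0)).Local v) × ((cmDatum L 1 (Matrix.of fun i j : Fin 1 => if i.val + j.val + 1 = 1 then (1 : L) else 0)).Local v))] [BorelSpace (((cmDatum L 2 (Matrix.of fun i j : Fin 2 => if i.val + j.val + 1 = 2 then (1 : L) else 0)).Local v) × ((cmDatum L 1 (Matrix.of fun i j : Fin 1 => if i.val + j.val + 1 = 1 then (1 : L) else 0)).Local v))]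
  [∀ aH : (((cmDatum L 2 (Matrix.of fun i j : Fin 2 => if i.val + j.val + 1 = 2 then (1 : L) else 0)).Local v) × ((cmDatum L 1 (Matrix.of fun i j : Fin 1 => if i.val + j.val + 1 = 1 then (1 : L) else 0)).Local v)), MeasurableSpace ((((cmDatum L 2 (Matrix.of fun i j : Fin 2 => if i.val + j.val + 1 = 2 then (1 : L) else 0)).Local v) × ((cmDatum L 1 (Matrix.of fun i j : Fin 1 => if i.val + j.val + 1 = 1 then (1 : L) else 0)).Local v)) ⧸ Subgroup.centralizer ({aH} : Set (((cmDatum L 2 (Matrix.of fun i j : Fin 2 => if i.val + j.val + 1 = 2 then (1 : L) else 0)).Local v) × ((cmDatum L 1 (Matrix.of fun i j : Fin 1 => if i.val + j.val + 1 = 1 then (1 : L) else 0)).Local v))))]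
  [∀ aH : (((cmDatum L 2 (Matrix.of fun i j : Fin 2 => if i.val + j.val + 1 = 2 then (1 : L) else 0)).Local v) × ((cmDatum L 1 (Matrix.of fun i j : Fin 1 => if i.val + j.val + 1 = 1 then (1 : L) else 0)).Local v)), BorelSpace ((((cmDatum L 2 (Matrix.of fun i j : Fin 2 => if i.val + j.val + 1 = 2 then (1 : L) else 0)).Local v) × ((cmDatum L 1 (Matrix.of fun i j : Fin 1 => if i.val + j.val + 1 = 1 then (1 : L) else 0)).Local v)) ⧸ Subgroup.centralizer ({aH} : Set (((cmDatum L 2 (Matrix.of fun i j : Fin 2 => if i.val + j.val + 1 = 2 then (1 : L) else 0)).Local v) × ((cmDatum L 1 (Matrix.of fun i j : Fin 1 => if i.val + j.val + 1 = 1 then (1 : L) else 0)).Local v))))]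
  [MeasurableSpace ↥(unitaryGroupOfForm (conjLocal L (IsCMField.complexConj L) v) (cmLocalForm L 2 v))] [BorelSpace ↥(unitaryGroupOfForm (conjLocal L (IsCMField.complexConj L) v) (cmLocalForm L 2 v))] [MeasurableSpace ((cmDatum L 1 (Matrix.of fun i j : Fin 1 => if i.val + j.val + 1 = 1 then (1 : L) else 0)).Local v)] [BorelSpace ((cmDatum L 1 (Matrix.of fun i j : Fin 1 => if i.val + j.val + 1 = 1 then (1 : L) else 0)).Local v)]

open scoped Classical in
set_option maxHeartbeats 4000000 in
set_option synthInstance.maxHeartbeats 400000 in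
/-- **② «HOH-SHELL-H» — the canonical `H`-orbital integral of a test function with two-coset PRODUCT-Haar spectral data, at a hyperbolic diagonal-Levi point, closed
form in the organ's own measure.**  Frame: `w ∣ v` fixed by `c`, Borel structures on `H_v = U(Φ₂)_v × U(Φ₁)_v`, its factors and the centraliser quotients, a Haar measure `ν_H` with
CANONICAL orbital measures `m_H` on the `G`-regular classes (`hmH : m_H.IsCanonical (IsLocalGRegular L v) ν_H` — the XIG binder), a Haar `μ_T` on `T₂`, `U(Φ₁)_v ⊆ K_{1,v}` (`hK₁`);
data `K₂ ≤ U(Φ₂)_v` compact open, `N : ℕ`, `D : ℂ`, `K₁ ≤ U(Φ₁)_v` compact open, `b₁ b₂ ∈ T₂`, `z₁`; `g ∈ C_c^∞(H_v)` with, for SOME Haar measures `ν₂`, `ν₁` on the factors,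
`tr i_H(χ₂ ⊠ χ₁)(g; ν₂ ⊗ ν₁) = [χ₂|_{T₂∩K₂} = 1 ∧ χ₁|_{K₁} = 1] · (ν₂(K₂)·N·ν₁(K₁)·D) · χ₁(z₁) · (χ₂(b₁) + 1·χ₂(b₂))` for every continuous `χ₂`, open-kernel `χ₁` (`hF1Hg` — EXACTLY the
output of ★ hF1H-ADAPTER p849948 `smoothTrace_cmPrincipalSeriesH_indicator_shell_eq_hF1H` at `g := 𝟙_{K_H (b,z₁) K_H}`, `K₂ := 𝓘₂.K n`, `N := #R₂`, `D := δ_{B₂}^{1∕2}(b)`, `b₁ := b`,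
`b₂ := ʷb`).  CONCLUSION = the `hOHj` clause of ★ KIT-A `hOH_of_summands` (p849774) for this `g`, token for token: at every `γ_H` with `γ_H.1 = diag(d′)`, `G`-regular,
`|d′₁|_w < |d′₀|_w`, `σ_w(d′₀)d′₁ = 1`, and every torus writing `t_H` of `γ_H.1` (`hdH`, `hb`),
`Φ(⟦(t_H, γ_H.2)⟧, g; m_H) = δ_{B₂}^{1∕2}(t_H)⁻¹ · J₂(t_H) · Φ (t_H, γ_H.2)`,  `Φ := fun x => κ_H · (𝟙_{(b₁,z₁)(C₂×K₁)} x + 1 · 𝟙_{(b₂,z₁)(C₂×K₁)} x)`,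
**`κ_H = ν_H(K₂ × U(Φ₁)_v) · N · D · μ_T{t ∈ K_{2,v}} ∕ μ_T(C₂)`**, `C₂ = K₂.comap (T₂ ↪ U(Φ₂)_v)` — the auxiliary `ν₂, ν₁` CANCEL (`ν_H = s·(ν₂ ⊗ ν₁)`, ★
`smoothTrace_eq_haarScalarFactor_mul_smoothTrace`, `s·ν₂(K₂)·ν₁(univ) = ν_H(K₂ × univ)`); `hae` by ★ HAE-H p849715; the point is regular and `G`-regular by ★
`isRegularElt_fst_snd_of_isLocalGRegular` ∕ ★ `isLocalGRegular_out_mk`.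
[cite: Rogawski1990, §4.9 (4.9.4) p. 56; §12.1 p. 171; §12.7 Lemma 12.7.3 (proof) p. 195] [cite: HewittRoss1979, Thm. (23.11)] -/
theorem classOrbitalIntegralH_eq_of_prodHaar_spectral
    (w : PlacesOver L v) (hw : IsCMField.complexConj L • w.1 = w.1)
    (νH : Measure (((cmDatum L 2 (Matrix.of fun i j : Fin 2 => if i.val + j.val + 1 = 2 then (1 : L) else 0)).Local v) × ((cmDatum L 1 (Matrix.of fun i j : Fin 1 => if i.val + j.val + 1 = 1 then (1 : L) else 0)).Local v))) [νH.IsHaarMeasure] [νH.IsMulRightInvariant]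
    {mH : OrbitalMeasureFamily (((cmDatum L 2 (Matrix.of fun i j : Fin 2 => if i.val + j.val + 1 = 2 then (1 : L) else 0)).Local v) × ((cmDatum L 1 (Matrix.of fun i j : Fin 1 => if i.val + j.val + 1 = 1 then (1 : L) else 0)).Local v))} (hmH : mH.IsCanonical (IsLocalGRegular L v) νH)
    (μT : Measure ↥(cmBorelTriple L 2 v).M) [μT.IsHaarMeasure]
    (hK₁ : ∀ x : ((cmDatum L 1 (Matrix.of fun i j : Fin 1 => if i.val + j.val + 1 = 1 then (1 : L) else 0)).Local v), x ∈ cmLocalIntegralLevel L 1 (Matrix.of fun i j : Fin 1 => if i.val + j.val + 1 = 1 then (1 : L) else 0) v)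
    -- the spectral data of `g` for SOME Haar measure `ν′` on `H_v` (★ hF1H-ADAPTER p849948's output shape at `ν′ = ν₂ ⊗ ν₁`, `ν₂(K₂)·ν₁(K₁) = ν′(K₂ × K₁)`)
    (ν' : Measure (((cmDatum L 2 (Matrix.of fun i j : Fin 2 => if i.val + j.val + 1 = 2 then (1 : L) else 0)).Local v) × ((cmDatum L 1 (Matrix.of fun i j : Fin 1 => if i.val + j.val + 1 = 1 then (1 : L) else 0)).Local v))) [ν'.IsHaarMeasure]
    (K₂ : Subgroup ↥(unitaryGroupOfForm (conjLocal L (IsCMField.complexConj L) v) (cmLocalForm L 2 v))) (hK₂o : IsOpen (K₂ : Set ↥(unitaryGroupOfForm (conjLocal L (IsCMField.complexConj L) v) (cmLocalForm L 2 v)))) (hK₂c : IsCompact (K₂ : Set ↥(unitaryGroupOfForm (conjLocal L (IsCMField.complexConj L) v) (cmLocalForm L 2 v)))) (N : ℕ) (D : ℂ)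
    (K₁ : Subgroup ((cmDatum L 1 (Matrix.of fun i j : Fin 1 => if i.val + j.val + 1 = 1 then (1 : L) else 0)).Local v)) (hK₁o : IsOpen (K₁ : Set ((cmDatum L 1 (Matrix.of fun i j : Fin 1 => if i.val + j.val + 1 = 1 then (1 : L) else 0)).Local v))) (hK₁c : IsCompact (K₁ : Set ((cmDatum L 1 (Matrix.of fun i j : Fin 1 => if i.val + j.val + 1 = 1 then (1 : L) else 0)).Local v)))
    (b₁ b₂ : ↥(cmBorelTriple L 2 v).M) (z₁ : ((cmDatum L 1 (Matrix.of fun i j : Fin 1 => if i.val + j.val + 1 = 1 then (1 : L) else 0)).Local v))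
    (g : (((cmDatum L 2 (Matrix.of fun i j : Fin 2 => if i.val + j.val + 1 = 2 then (1 : L) else 0)).Local v) × ((cmDatum L 1 (Matrix.of fun i j : Fin 1 => if i.val + j.val + 1 = 1 then (1 : L) else 0)).Local v)) → ℂ) (hg : IsLocSmooth g)
    (hF1Hg : haveI := locallyCompactSpace_cmBorelU L 2 v
      ∀ (χ₂ : ↥(torusU (conjLocal L (IsCMField.complexConj L) v) (cmLocalForm L 2 v)) →* ℂˣ) (_hχ₂ : Continuous fun t => ((χ₂ t : ℂˣ) : ℂ))
        (χ₁ : ((cmDatum L 1 (Matrix.of fun i j : Fin 1 => if i.val + j.val + 1 = 1 then (1 : L) else 0)).Local v) →* ℂˣ) (_hχ₁ : IsOpen ((χ₁.ker : Subgroup ((cmDatum L 1 (Matrix.of fun i j : Fin 1 => if i.val + j.val + 1 = 1 then (1 : L) else 0)).Local v)) : Set ((cmDatum L 1 (Matrix.of fun i j : Fin 1 => if i.val + j.val + 1 = 1 then (1 : L) else 0)).Local v))),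
        (cmPrincipalSeriesH L v χ₂ χ₁).smoothTrace ν' g =
          if (∀ c ∈ K₂.comap (cmBorelTriple L 2 v).M.subtype, χ₂ c = 1) ∧ (∀ k ∈ K₁, χ₁ k = 1)
          then ((ν'.real (((K₂.prod K₁ : Subgroup (↥(unitaryGroupOfForm (conjLocal L (IsCMField.complexConj L) v) (cmLocalForm L 2 v)) × ((cmDatum L 1 (Matrix.of fun i j : Fin 1 => if i.val + j.val + 1 = 1 then (1 : L) else 0)).Local v))) : Set (↥(unitaryGroupOfForm (conjLocal L (IsCMField.complexConj L) v) (cmLocalForm L 2 v)) × ((cmDatum L 1 (Matrix.of fun i j : Fin 1 => if i.val + j.val + 1 = 1 then (1 : L) else 0)).Local v)))) : ℂ) * (N : ℂ) * D) * ((χ₁ z₁ : ℂˣ) : ℂ) *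
            (((χ₂ b₁ : ℂˣ) : ℂ) + 1 * ((χ₂ b₂ : ℂˣ) : ℂ))
          else 0)
    -- the `hOHj` binders of ★ KIT-A `hOH_of_summands`
    (γH : (((cmDatum L 2 (Matrix.of fun i j : Fin 2 => if i.val + j.val + 1 = 2 then (1 : L) else 0)).Local v) × ((cmDatum L 1 (Matrix.of fun i j : Fin 1 => if i.val + j.val + 1 = 1 then (1 : L) else 0)).Local v))) (d' : Fin 2 → (LocalRing L v)ˣ) (_hd' : glDiagonal 2 (LocalRing L v) d' = ((γH.1).val : GL (Fin 2) (LocalRing L v)))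
    (hreg : IsLocalGRegular L v γH)
    (_hlt : Valued.v (((d' 1 : (LocalRing L v)ˣ) : LocalRing L v) w) < Valued.v (((d' 0 : (LocalRing L v)ˣ) : LocalRing L v) w))
    (_h01 : galAdicCompletionMap (L := L) (IsCMField.complexConj L) hw (((d' 0 : (LocalRing L v)ˣ) : LocalRing L v) w) * ((d' 1 : (LocalRing L v)ˣ) : LocalRing L v) w = 1)
    (tH : ↥(cmBorelTriple L 2 v).M) (htH : (tH : ↥(unitaryGroupOfForm (conjLocal L (IsCMField.complexConj L) v) (cmLocalForm L 2 v))) = γH.1)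
    (hdH : glDiagonal 2 (LocalRing L v) d' = ((tH : ↥(unitaryGroupOfForm (conjLocal L (IsCMField.complexConj L) v) (cmLocalForm L 2 v))) : GL (Fin 2) (LocalRing L v)))
    (hb : IsUnit ((((d' 0)⁻¹ * d' 1 : (LocalRing L v)ˣ) : LocalRing L v) - 1)) :
    haveI := locallyCompactSpace_cmBorelU L 2 v
    classOrbitalIntegral mH g (ConjClasses.mk (((tH : ↥(unitaryGroupOfForm (conjLocal L (IsCMField.complexConj L) v) (cmLocalForm L 2 v))) : ((cmDatum L 2 (Matrix.of fun i j : Fin 2 => if i.val + j.val + 1 = 2 then (1 : L) else 0)).Local v)), γH.2)) =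
      ((rootDeltaChar (cmBorelTriple L 2 v).P ⟨(tH : ↥(unitaryGroupOfForm (conjLocal L (IsCMField.complexConj L) v) (cmLocalForm L 2 v))), (cmBorelTriple L 2 v).M_le tH.2⟩ : ℂˣ) : ℂ)⁻¹ *
        (((letI : MeasurableSpace (LocalRing L v) := borel _; haveI : BorelSpace (LocalRing L v) := ⟨rfl⟩
          haveI : SecondCountableTopology (LocalRing L v) := secondCountableTopology_localRing (E := L) v
          ((HeisRing.skewModulus (conjLocal L (IsCMField.complexConj L) v) (continuous_conjLocal L (IsCMField.complexConj L) v) hb.unit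
            (LineRing.map_unit_torusScalar_sub_one_two (conjLocal L (IsCMField.complexConj L) v) (cmLocalForm_eq_over L 2 v)
              (⟨(tH : ↥(unitaryGroupOfForm (conjLocal L (IsCMField.complexConj L) v) (cmLocalForm L 2 v))), tH.2⟩ : ↥(torusU (conjLocal L (IsCMField.complexConj L) v) (cmLocalForm L 2 v))) hdH hb))⁻¹ : ℝ≥0)) : ℝ) : ℂ) *
        (fun x : ↥(cmBorelTriple L 2 v).M × ((cmDatum L 1 (Matrix.of fun i j : Fin 1 => if i.val + j.val + 1 = 1 then (1 : L) else 0)).Local v) =>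
          (((νH.real (((K₂.prod (⊤ : Subgroup ((cmDatum L 1 (Matrix.of fun i j : Fin 1 => if i.val + j.val + 1 = 1 then (1 : L) else 0)).Local v)) : Subgroup (↥(unitaryGroupOfForm (conjLocal L (IsCMField.complexConj L) v) (cmLocalForm L 2 v)) × ((cmDatum L 1 (Matrix.of fun i j : Fin 1 => if i.val + j.val + 1 = 1 then (1 : L) else 0)).Local v))) : Set (↥(unitaryGroupOfForm (conjLocal L (IsCMField.complexConj L) v) (cmLocalForm L 2 v)) × ((cmDatum L 1 (Matrix.of fun i j : Fin 1 => if i.val + j.val + 1 = 1 then (1 : L) else 0)).Local v)))) : ℝ) : ℂ) * (N : ℂ) * D *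
              ((μT.real {t : ↥(cmBorelTriple L 2 v).M | (t : ↥(unitaryGroupOfForm (conjLocal L (IsCMField.complexConj L) v) (cmLocalForm L 2 v))) ∈ cmLocalIntegralLevel L 2 (Matrix.of fun i j : Fin 2 => if i.val + j.val + 1 = 2 then (1 : L) else 0) v} : ℝ) : ℂ) /
              ((μT.real ((K₂.comap (cmBorelTriple L 2 v).M.subtype : Subgroup ↥(cmBorelTriple L 2 v).M) : Set ↥(cmBorelTriple L 2 v).M) : ℝ) : ℂ)) *
          ({x : ↥(cmBorelTriple L 2 v).M × ((cmDatum L 1 (Matrix.of fun i j : Fin 1 => if i.val + j.val + 1 = 1 then (1 : L) else 0)).Local v) | (b₁, z₁)⁻¹ * x ∈ (((K₂.comap (cmBorelTriple L 2 v).M.subtype).prod K₁ : Subgroup (↥(cmBorelTriple L 2 v).M × ((cmDatum L 1 (Matrix.of fun i j : Fin 1 => if i.val + j.val + 1 = 1 then (1 : L) else 0)).Local v))) : Set (↥(cmBorelTriple L 2 v).M × ((cmDatum L 1 (Matrix.of fun i j : Fin 1 => if i.val + j.val + 1 = 1 then (1 : L) else 0)).Local v)))}.indicator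
              (fun _ => (1 : ℂ)) x +
            1 * {x : ↥(cmBorelTriple L 2 v).M × ((cmDatum L 1 (Matrix.of fun i j : Fin 1 => if i.val + j.val + 1 = 1 then (1 : L) else 0)).Local v) | (b₂, z₁)⁻¹ * x ∈ (((K₂.comap (cmBorelTriple L 2 v).M.subtype).prod K₁ : Subgroup (↥(cmBorelTriple L 2 v).M × ((cmDatum L 1 (Matrix.of fun i j : Fin 1 => if i.val + j.val + 1 = 1 then (1 : L) else 0)).Local v))) : Set (↥(cmBorelTriple L 2 v).M × ((cmDatum L 1 (Matrix.of fun i j : Fin 1 => if i.val + j.val + 1 = 1 then (1 : L) else 0)).Local v)))}.indicator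
              (fun _ => (1 : ℂ)) x))
          (tH, γH.2) := by
  haveI := locallyCompactSpace_cmBorelU L 2 v
  -- §0 carriers ∕ instances (both spellings of the `U(Φ₂)` factor)
  letI : MeasurableSpace ((cmDatum L 2 (Matrix.of fun i j : Fin 2 => if i.val + j.val + 1 = 2 then (1 : L) else 0)).Local v) := ‹MeasurableSpace ↥(unitaryGroupOfForm (conjLocal L (IsCMField.complexConj L) v) (cmLocalForm L 2 v))›
  haveI : BorelSpace ((cmDatum L 2 (Matrix.of fun i j : Fin 2 => if i.val + j.val + 1 = 2 then (1 : L) else 0)).Local v) := ‹BorelSpace ↥(unitaryGroupOfForm (conjLocal L (IsCMField.complexConj L) v) (cmLocalForm L 2 v))›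
  haveI : LocallyCompactSpace ↥(unitaryGroupOfForm (conjLocal L (IsCMField.complexConj L) v) (cmLocalForm L 2 v)) := locallyCompactSpace_local (IsCMField.complexConj L) 2 _ v
  haveI : SecondCountableTopology ↥(unitaryGroupOfForm (conjLocal L (IsCMField.complexConj L) v) (cmLocalForm L 2 v)) := secondCountableTopology_local (IsCMField.complexConj L) 2 _ v
  haveI : T2Space ↥(unitaryGroupOfForm (conjLocal L (IsCMField.complexConj L) v) (cmLocalForm L 2 v)) := t2Space_cmDatum_local 2 L (Matrix.of fun i j : Fin 2 => if i.val + j.val + 1 = 2 then (1 : L) else 0) v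
  haveI : NonarchimedeanGroup ↥(unitaryGroupOfForm (conjLocal L (IsCMField.complexConj L) v) (cmLocalForm L 2 v)) := nonarchimedeanGroup_cmLocal L 2 v
  haveI : LocallyCompactSpace ((cmDatum L 1 (Matrix.of fun i j : Fin 1 => if i.val + j.val + 1 = 1 then (1 : L) else 0)).Local v) := locallyCompactSpace_local (IsCMField.complexConj L) 1 _ v
  haveI : SecondCountableTopology ((cmDatum L 1 (Matrix.of fun i j : Fin 1 => if i.val + j.val + 1 = 1 then (1 : L) else 0)).Local v) := secondCountableTopology_local (IsCMField.complexConj L) 1 _ v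
  haveI : T2Space ((cmDatum L 1 (Matrix.of fun i j : Fin 1 => if i.val + j.val + 1 = 1 then (1 : L) else 0)).Local v) := t2Space_cmDatum_local 1 L (Matrix.of fun i j : Fin 1 => if i.val + j.val + 1 = 1 then (1 : L) else 0) v
  haveI : NonarchimedeanGroup ((cmDatum L 1 (Matrix.of fun i j : Fin 1 => if i.val + j.val + 1 = 1 then (1 : L) else 0)).Local v) := nonarchimedeanGroup_cmLocal L 1 v
  haveI : LocallyCompactSpace ((cmDatum L 2 (Matrix.of fun i j : Fin 2 => if i.val + j.val + 1 = 2 then (1 : L) else 0)).Local v) := ‹LocallyCompactSpace ↥(unitaryGroupOfForm (conjLocal L (IsCMField.complexConj L) v) (cmLocalForm L 2 v))›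
  haveI : SecondCountableTopology ((cmDatum L 2 (Matrix.of fun i j : Fin 2 => if i.val + j.val + 1 = 2 then (1 : L) else 0)).Local v) := ‹SecondCountableTopology ↥(unitaryGroupOfForm (conjLocal L (IsCMField.complexConj L) v) (cmLocalForm L 2 v))›
  haveI : T2Space ((cmDatum L 2 (Matrix.of fun i j : Fin 2 => if i.val + j.val + 1 = 2 then (1 : L) else 0)).Local v) := ‹T2Space ↥(unitaryGroupOfForm (conjLocal L (IsCMField.complexConj L) v) (cmLocalForm L 2 v))›
  haveI : NonarchimedeanGroup ((cmDatum L 2 (Matrix.of fun i j : Fin 2 => if i.val + j.val + 1 = 2 then (1 : L) else 0)).Local v) := ‹NonarchimedeanGroup ↥(unitaryGroupOfForm (conjLocal L (IsCMField.complexConj L) v) (cmLocalForm L 2 v))›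
  haveI : T1Space (LocalRing L v) := inferInstance
  haveI : SigmaCompactSpace ((cmDatum L 2 (Matrix.of fun i j : Fin 2 => if i.val + j.val + 1 = 2 then (1 : L) else 0)).Local v) := sigmaCompactSpace_of_locallyCompact_secondCountable
  haveI : SigmaCompactSpace ((cmDatum L 1 (Matrix.of fun i j : Fin 1 => if i.val + j.val + 1 = 1 then (1 : L) else 0)).Local v) := sigmaCompactSpace_of_locallyCompact_secondCountable
  have hTcl := isClosed_torusU_of_t1Space (conjLocal L (IsCMField.complexConj L) v) (cmLocalForm L 2 v)
  -- the Borel structure `mHH` IS the product structure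
  have hmeq : mHH = @Prod.instMeasurableSpace ((cmDatum L 2 (Matrix.of fun i j : Fin 2 => if i.val + j.val + 1 = 2 then (1 : L) else 0)).Local v) ((cmDatum L 1 (Matrix.of fun i j : Fin 1 => if i.val + j.val + 1 = 1 then (1 : L) else 0)).Local v) _ _ :=
    (‹BorelSpace (((cmDatum L 2 (Matrix.of fun i j : Fin 2 => if i.val + j.val + 1 = 2 then (1 : L) else 0)).Local v) × ((cmDatum L 1 (Matrix.of fun i j : Fin 1 => if i.val + j.val + 1 = 1 then (1 : L) else 0)).Local v))›.measurable_eq).trans (@BorelSpace.measurable_eq (((cmDatum L 2 (Matrix.of fun i j : Fin 2 => if i.val + j.val + 1 = 2 then (1 : L) else 0)).Local v) × ((cmDatum L 1 (Matrix.of fun i j : Fin 1 => if i.val + j.val + 1 = 1 then (1 : L) else 0)).Local v)) _ Prod.instMeasurableSpace Prod.borelSpace).symm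
  subst hmeq
  -- auxiliary Haar measures on the factors; `ν_H = r · ν′`, `ν′ = s′ · (ν₂ ⊗ ν₁)`
  let ν₂ : Measure ((cmDatum L 2 (Matrix.of fun i j : Fin 2 => if i.val + j.val + 1 = 2 then (1 : L) else 0)).Local v) := Measure.haar
  let ν₁ : Measure ((cmDatum L 1 (Matrix.of fun i j : Fin 1 => if i.val + j.val + 1 = 1 then (1 : L) else 0)).Local v) := Measure.haar
  haveI : SigmaFinite ν₂ := inferInstance
  haveI : SigmaFinite ν₁ := inferInstance
  haveI : (ν₂.prod ν₁).IsHaarMeasure := inferInstance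
  set r : ℝ≥0 := haarScalarFactor νH ν' with hrdef
  set s' : ℝ≥0 := haarScalarFactor ν' (ν₂.prod ν₁) with hs'def
  -- (b) the spectral data scaled to `ν_H`
  obtain ⟨Kl, hKl⟩ := exists_isLevel (G := (((cmDatum L 2 (Matrix.of fun i j : Fin 2 => if i.val + j.val + 1 = 2 then (1 : L) else 0)).Local v) × ((cmDatum L 1 (Matrix.of fun i j : Fin 1 => if i.val + j.val + 1 = 1 then (1 : L) else 0)).Local v))) ⟨hg.1, hg.2⟩
  have hF1H : ∀ (χ₂ : ↥(torusU (conjLocal L (IsCMField.complexConj L) v) (cmLocalForm L 2 v)) →* ℂˣ) (_hχ₂ : Continuous fun t => ((χ₂ t : ℂˣ) : ℂ))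
      (χ₁ : ((cmDatum L 1 (Matrix.of fun i j : Fin 1 => if i.val + j.val + 1 = 1 then (1 : L) else 0)).Local v) →* ℂˣ) (_hχ₁ : IsOpen ((χ₁.ker : Subgroup ((cmDatum L 1 (Matrix.of fun i j : Fin 1 => if i.val + j.val + 1 = 1 then (1 : L) else 0)).Local v)) : Set ((cmDatum L 1 (Matrix.of fun i j : Fin 1 => if i.val + j.val + 1 = 1 then (1 : L) else 0)).Local v))),
      (cmPrincipalSeriesH L v χ₂ χ₁).smoothTrace νH g =
        if (∀ c ∈ K₂.comap (cmBorelTriple L 2 v).M.subtype, χ₂ c = 1) ∧ (∀ k ∈ K₁, χ₁ k = 1)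
        then ((r : ℂ) * ((ν'.real (((K₂.prod K₁ : Subgroup (↥(unitaryGroupOfForm (conjLocal L (IsCMField.complexConj L) v) (cmLocalForm L 2 v)) × ((cmDatum L 1 (Matrix.of fun i j : Fin 1 => if i.val + j.val + 1 = 1 then (1 : L) else 0)).Local v))) : Set (↥(unitaryGroupOfForm (conjLocal L (IsCMField.complexConj L) v) (cmLocalForm L 2 v)) × ((cmDatum L 1 (Matrix.of fun i j : Fin 1 => if i.val + j.val + 1 = 1 then (1 : L) else 0)).Local v)))) : ℂ) * (N : ℂ) * D)) * ((χ₁ z₁ : ℂˣ) : ℂ) *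
          (((χ₂ b₁ : ℂˣ) : ℂ) + 1 * ((χ₂ b₂ : ℂˣ) : ℂ))
        else 0 := by
    intro χ₂ hχ₂ χ₁ hχ₁
    have hadm := isAdmissible_cmPrincipalSeriesH L v χ₂ χ₁ hχ₁
    rw [Representation.smoothTrace_eq_haarScalarFactor_mul_smoothTrace (cmPrincipalSeriesH L v χ₂ χ₁) νH ν' hadm hg.2 hKl,
      hF1Hg χ₂ hχ₂ χ₁ hχ₁]
    split_ifs <;> ring
  -- (c) the point: regular, `G`-regular
  have hγ : ((((tH : ↥(unitaryGroupOfForm (conjLocal L (IsCMField.complexConj L) v) (cmLocalForm L 2 v))) : ((cmDatum L 2 (Matrix.of fun i j : Fin 2 => if i.val + j.val + 1 = 2 then (1 : L) else 0)).Local v)), γH.2) : (((cmDatum L 2 (Matrix.of fun i j : Fin 2 => if i.val + j.val + 1 = 2 then (1 : L) else 0)).Local v) × ((cmDatum L 1 (Matrix.of fun i j : Fin 1 => if i.val + j.val + 1 = 1 then (1 : L) else 0)).Local v))) = γH := Prod.ext htH rfl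
  have hregH : IsLocalGRegular L v (((tH : ↥(unitaryGroupOfForm (conjLocal L (IsCMField.complexConj L) v) (cmLocalForm L 2 v))) : ((cmDatum L 2 (Matrix.of fun i j : Fin 2 => if i.val + j.val + 1 = 2 then (1 : L) else 0)).Local v)), γH.2) := by rw [hγ]; exact hreg
  have hreg₂ : IsRegularElt ((tH : ↥(unitaryGroupOfForm (conjLocal L (IsCMField.complexConj L) v) (cmLocalForm L 2 v))) : GL (Fin 2) (LocalRing L v)) := (isRegularElt_fst_snd_of_isLocalGRegular L v _ hregH).1
  have hPH : IsLocalGRegular L v (Quotient.out (ConjClasses.mk ((((tH : ↥(unitaryGroupOfForm (conjLocal L (IsCMField.complexConj L) v) (cmLocalForm L 2 v))) : ((cmDatum L 2 (Matrix.of fun i j : Fin 2 => if i.val + j.val + 1 = 2 then (1 : L) else 0)).Local v)), γH.2) : (((cmDatum L 2 (Matrix.of fun i j : Fin 2 => if i.val + j.val + 1 = 2 then (1 : L) else 0)).Local v) × ((cmDatum L 1 (Matrix.of fun i j : Fin 1 => if i.val + j.val + 1 = 1 then (1 : L) else 0)).Local v))))) := isLocalGRegular_out_mk hregH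
  -- `C₂ = T₂ ∩ K_{2,n}` is compact open
  have hC₂o : IsOpen (((K₂.comap (cmBorelTriple L 2 v).M.subtype : Subgroup ↥(cmBorelTriple L 2 v).M)) : Set ↥(cmBorelTriple L 2 v).M) := hK₂o.preimage continuous_subtype_val
  have hC₂c : IsCompact (((K₂.comap (cmBorelTriple L 2 v).M.subtype : Subgroup ↥(cmBorelTriple L 2 v).M)) : Set ↥(cmBorelTriple L 2 v).M) :=
    hTcl.isClosedEmbedding_subtypeVal.isCompact_preimage hK₂c
  -- ★ D3-ii-H from the spectral data, `hae` by ★ HAE-H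
  have hO := classOrbitalIntegralH_eq_twoCoset_of_spectral L w hw νH hmH μT ν₁ hK₁ g hg.1 hg.2
    (ae_ae_isRegularElt_and_isLocalGRegular L v μT ν₁) (K₂.comap (cmBorelTriple L 2 v).M.subtype) hC₂o hC₂c K₁ hK₁o hK₁c
    b₁ b₂ z₁ _ 1 hF1H tH γH.2 d' hdH hb hreg₂ hPH
  rw [hO]
  beta_reduce
  congr 1
  congr 1
  -- the constant: `r·ν′(K₂×K₁)·ν₁(univ)∕ν₁(K₁) = ν_H(K₂ × univ)` (boxes under `ν′ = s′·(ν₂ ⊗ ν₁)`, `ν_H = r·ν′`)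
  have hνt : νH = r • ν' := isMulLeftInvariant_eq_smul νH ν'
  have hνs : ν' = s' • (ν₂.prod ν₁) := isMulLeftInvariant_eq_smul ν' (ν₂.prod ν₁)
  have hbox₁ : ν'.real (((K₂.prod K₁ : Subgroup (↥(unitaryGroupOfForm (conjLocal L (IsCMField.complexConj L) v) (cmLocalForm L 2 v)) × ((cmDatum L 1 (Matrix.of fun i j : Fin 1 => if i.val + j.val + 1 = 1 then (1 : L) else 0)).Local v))) : Set (↥(unitaryGroupOfForm (conjLocal L (IsCMField.complexConj L) v) (cmLocalForm L 2 v)) × ((cmDatum L 1 (Matrix.of fun i j : Fin 1 => if i.val + j.val + 1 = 1 then (1 : L) else 0)).Local v)))) = (s' : ℝ) * (ν₂.real (K₂ : Set ↥(unitaryGroupOfForm (conjLocal L (IsCMField.complexConj L) v) (cmLocalForm L 2 v))) * ν₁.real (K₁ : Set ((cmDatum L 1 (Matrix.of fun i j : Fin 1 => if i.val + j.val + 1 = 1 then (1 : L) else 0)).Local v))) := by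
    have h1 := congrArg (fun m : Measure (((cmDatum L 2 (Matrix.of fun i j : Fin 2 => if i.val + j.val + 1 = 2 then (1 : L) else 0)).Local v) × ((cmDatum L 1 (Matrix.of fun i j : Fin 1 => if i.val + j.val + 1 = 1 then (1 : L) else 0)).Local v)) => m (((K₂.prod K₁ : Subgroup (↥(unitaryGroupOfForm (conjLocal L (IsCMField.complexConj L) v) (cmLocalForm L 2 v)) × ((cmDatum L 1 (Matrix.of fun i j : Fin 1 => if i.val + j.val + 1 = 1 then (1 : L) else 0)).Local v))) : Set (↥(unitaryGroupOfForm (conjLocal L (IsCMField.complexConj L) v) (cmLocalForm L 2 v)) × ((cmDatum L 1 (Matrix.of fun i j : Fin 1 => if i.val + j.val + 1 = 1 then (1 : L) else 0)).Local v))))) hνs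
    rw [measureReal_def, h1, Measure.coe_nnreal_smul_apply, Subgroup.coe_prod]
    erw [Measure.prod_prod]
    rw [ENNReal.toReal_mul, ENNReal.toReal_mul, ENNReal.coe_toReal]
    rfl
  have hbox₂ : νH.real (((K₂.prod (⊤ : Subgroup ((cmDatum L 1 (Matrix.of fun i j : Fin 1 => if i.val + j.val + 1 = 1 then (1 : L) else 0)).Local v)) : Subgroup (↥(unitaryGroupOfForm (conjLocal L (IsCMField.complexConj L) v) (cmLocalForm L 2 v)) × ((cmDatum L 1 (Matrix.of fun i j : Fin 1 => if i.val + j.val + 1 = 1 then (1 : L) else 0)).Local v))) : Set (↥(unitaryGroupOfForm (conjLocal L (IsCMField.complexConj L) v) (cmLocalForm L 2 v)) × ((cmDatum L 1 (Matrix.of fun i j : Fin 1 => if i.val + j.val + 1 = 1 then (1 : L) else 0)).Local v)))) =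
      (r : ℝ) * ((s' : ℝ) * (ν₂.real (K₂ : Set ↥(unitaryGroupOfForm (conjLocal L (IsCMField.complexConj L) v) (cmLocalForm L 2 v))) * ν₁.real Set.univ)) := by
    have h1 := congrArg (fun m : Measure (((cmDatum L 2 (Matrix.of fun i j : Fin 2 => if i.val + j.val + 1 = 2 then (1 : L) else 0)).Local v) × ((cmDatum L 1 (Matrix.of fun i j : Fin 1 => if i.val + j.val + 1 = 1 then (1 : L) else 0)).Local v)) => m (((K₂.prod (⊤ : Subgroup ((cmDatum L 1 (Matrix.of fun i j : Fin 1 => if i.val + j.val + 1 = 1 then (1 : L) else 0)).Local v)) : Subgroup (↥(unitaryGroupOfForm (conjLocal L (IsCMField.complexConj L) v) (cmLocalForm L 2 v)) × ((cmDatum L 1 (Matrix.of fun i j : Fin 1 => if i.val + j.val + 1 = 1 then (1 : L) else 0)).Local v))) : Set (↥(unitaryGroupOfForm (conjLocal L (IsCMField.complexConj L) v) (cmLocalForm L 2 v)) × ((cmDatum L 1 (Matrix.of fun i j : Fin 1 => if i.val + j.val + 1 = 1 then (1 : L) else 0)).Local v))))) hνt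
    have h2 := congrArg (fun m : Measure (((cmDatum L 2 (Matrix.of fun i j : Fin 2 => if i.val + j.val + 1 = 2 then (1 : L) else 0)).Local v) × ((cmDatum L 1 (Matrix.of fun i j : Fin 1 => if i.val + j.val + 1 = 1 then (1 : L) else 0)).Local v)) => m (((K₂.prod (⊤ : Subgroup ((cmDatum L 1 (Matrix.of fun i j : Fin 1 => if i.val + j.val + 1 = 1 then (1 : L) else 0)).Local v)) : Subgroup (↥(unitaryGroupOfForm (conjLocal L (IsCMField.complexConj L) v) (cmLocalForm L 2 v)) × ((cmDatum L 1 (Matrix.of fun i j : Fin 1 => if i.val + j.val + 1 = 1 then (1 : L) else 0)).Local v))) : Set (↥(unitaryGroupOfForm (conjLocal L (IsCMField.complexConj L) v) (cmLocalForm L 2 v)) × ((cmDatum L 1 (Matrix.of fun i j : Fin 1 => if i.val + j.val + 1 = 1 then (1 : L) else 0)).Local v))))) hνs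
    rw [measureReal_def, h1, Measure.coe_nnreal_smul_apply, h2, Measure.coe_nnreal_smul_apply, Subgroup.coe_prod, Subgroup.coe_top]
    erw [Measure.prod_prod]
    rw [ENNReal.toReal_mul, ENNReal.toReal_mul, ENNReal.toReal_mul, ENNReal.coe_toReal, ENNReal.coe_toReal]
    rfl
  have hK1pos : ((ν₁.real (K₁ : Set ((cmDatum L 1 (Matrix.of fun i j : Fin 1 => if i.val + j.val + 1 = 1 then (1 : L) else 0)).Local v)) : ℝ) : ℂ) ≠ 0 := by
    exact_mod_cast (ENNReal.toReal_pos (hK₁o.measure_ne_zero ν₁ ⟨1, K₁.one_mem⟩) hK₁c.measure_lt_top.ne).ne'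
  have hC₂pos : ((μT.real (((K₂.comap (cmBorelTriple L 2 v).M.subtype : Subgroup ↥(cmBorelTriple L 2 v).M)) : Set ↥(cmBorelTriple L 2 v).M) : ℝ) : ℂ) ≠ 0 := by
    exact_mod_cast (ENNReal.toReal_pos (hC₂o.measure_ne_zero μT ⟨1, Subgroup.one_mem _⟩) hC₂c.measure_lt_top.ne).ne'
  rw [hbox₁, hbox₂]
  push_cast
  field_simp

end CM

end Summit.HodgeConjecture.HodgeConjecture.Cruxes.H413.F0P3cStCharTSHohShellH

end
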